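import Mathlib
import HarnessLib
import Summits.KontsevichZagierPeriods.KontsevichZagierPeriods.Theorems.LinRedNormalFormDihedralNormalFormStubAtomReductionAux4
import Summits.KontsevichZagierPeriods.KontsevichZagierPeriods.Theorems.LinRedNormalFormDihedralNormalFormStubAtomConvergenceAux1

/-!
# Tool stub `atomConvergence` of the line `torus-descent-sum-shadow` (crux `DihedralNormalForm`):
the convergence criterion of cubical atoms

The cubical atom `q · ∏ xᵢ^{aᵢ} · ∏_{i ≤ j} (1 - xᵢ ⋯ xⱼ)^{e i j}` (`q ≠ 0`, `a ∈ ℕᵏ`, `e ∈ ℤ`) is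
absolutely integrable on the open cube `(0,1)ᵏ` iff for every interval `J = [i, j]`

  `0 ≤ (j - i) + ∑ {e i' j' | i ≤ i' ≤ j' ≤ j}`

(Brown's convergence criterion in cubical coordinates). Proof:

* the constant `q ≠ 0` is irrelevant and the flip `v = 1 - x` turns the atom into the chordal
  weight `∏ (1 - vₗ)^{aₗ} · ∏_{i ≤ j} (1 - ∏_{l ∈ [i,j]} (1 - vₗ))^{e i j}` (`atomFun_one_sub`);
* part I (`…StubAtomConvergenceAux1`, `integrableOn_weightV_iff`): by the order sectors and their
  nested monomial charts, the weight is integrable iff for every permutation `π` and every `i₀`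
  the set `T = π {i₀, …, k-1}` satisfies `|T| + ∑ {e_I | I ⊆ T} ≥ 1`;
* the sets `T` so obtained are all non-empty sets of coordinates; every interval is one of them
  (`exists_perm_map_Ici_eq_Icc`, a rotation), and conversely a non-empty `T` splits at its first
  gap into its first maximal run and the rest, an interval inside `T` lying in exactly one of the
  two (`isum_split`), so the interval conditions add up to the condition for `T` (`isum_runs`).

Recurring terms are written through parse-time notations (`CP⟪⟫`, `ATOM⟪⟫`, `CHORD⟪⟫`, `WEIGHT⟪⟫`,
`ISET⟪⟫`, `IEXP⟪⟫`, `ISUM⟪⟫`); the file introduces no definitions.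
-/

noncomputable section

open MeasureTheory Set Filter Topology

namespace Summit.KontsevichZagierPeriods.DihedralNormalForm.TorusDescent

namespace AtomConvergence

open Summit.KontsevichZagierPeriods.DihedralNormalForm.TorusDescent.AtomReduction

/-! ### Notation (parse-time abbreviations; no definitions are introduced) -/

set_option quotPrecheck false

local notation "CP⟪" k ", " i ", " j ", " x "⟫" =>
  (∏ l : Fin k, if i ≤ l ∧ l ≤ j then x l else (1:ℝ))
local notation "ATOM⟪" k ", " a ", " e ", " x "⟫" =>
  ((∏ i : Fin k, x i ^ (a i : ℕ)) *
    ∏ i : Fin k, ∏ j : Fin k, if i ≤ j then (1 - CP⟪k, i, j, x⟫) ^ (e i j : ℤ) else (1:ℝ))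
local notation "CHORD⟪" I ", " v "⟫" => ((1:ℝ) - ∏ l ∈ I, (1 - v l))
local notation "WEIGHT⟪" I ", " γ ", " d ", " v "⟫" =>
  ((∏ l, (1 - v l) ^ (d l : ℕ)) * ∏ a, CHORD⟪I a, v⟫ ^ (γ a : ℤ))
/-- The interval sets of an exponent matrix `e`, indexed by all pairs (a singleton off the
triangle `i ≤ j`, where the exponent below is `0`). -/
local notation "ISET⟪" k ", " p "⟫" =>
  (if Prod.fst p ≤ Prod.snd p then Finset.Icc (Prod.fst p) (Prod.snd p)
    else ({Prod.fst p} : Finset (Fin k)))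
local notation "IEXP⟪" e ", " p "⟫" =>
  (if Prod.fst p ≤ Prod.snd p then (e (Prod.fst p) (Prod.snd p) : ℤ) else 0)
/-- `∑ {e i' j' | [i', j'] ⊆ T}`: the total exponent of the chords inside a set `T`. -/
local notation "ISUM⟪" k ", " e ", " T "⟫" =>
  (∑ i' : Fin k, ∑ j' : Fin k, if i' ≤ j' ∧ Finset.Icc i' j' ⊆ T then (e i' j' : ℤ) else 0)

set_option quotPrecheck true

variable {k : ℕ}

/-! ### Combinatorics of intervals: runs of a set of coordinates -/

/-- **Splitting at a gap.** If `j + 1 ∉ T`, an interval inside `T` lies either below or above the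
gap, so the interval sum of `T` splits accordingly. -/
theorem isum_split (e : Fin k → Fin k → ℤ) (T : Finset (Fin k)) (j : Fin k)
    (hj : ∀ l ∈ T, (l : ℕ) ≠ (j : ℕ) + 1) :
    ISUM⟪k, e, T⟫ =
      ISUM⟪k, e, (T.filter fun l => l ≤ j)⟫ + ISUM⟪k, e, (T.filter fun l => j < l)⟫ := by
  rw [← Finset.sum_add_distrib]
  refine Finset.sum_congr rfl fun i' _ => ?_
  rw [← Finset.sum_add_distrib]
  refine Finset.sum_congr rfl fun j' _ => ?_
  by_cases hij : i' ≤ j'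
  · by_cases hT : Finset.Icc i' j' ⊆ T
    · rw [if_pos ⟨hij, hT⟩]
      by_cases hj' : j' ≤ j
      · -- the interval lies below the gap
        have hA : Finset.Icc i' j' ⊆ T.filter fun l => l ≤ j := fun l hl =>
          Finset.mem_filter.2 ⟨hT hl, (Finset.mem_Icc.1 hl).2.trans hj'⟩
        have hB : ¬ (i' ≤ j' ∧ Finset.Icc i' j' ⊆ T.filter fun l => j < l) := fun h =>
          absurd ((Finset.mem_filter.1 (h.2 (Finset.left_mem_Icc.2 hij))).2.trans_le
            (hij.trans hj')) (lt_irrefl _)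
        rw [if_pos ⟨hij, hA⟩, if_neg hB, add_zero]
      · -- the interval lies above the gap
        have hji' : j < i' := by
          by_contra hle
          rw [not_lt] at hle
          have hlt : (j : ℕ) + 1 < k := by
            have := j'.isLt
            have := Fin.lt_def.1 (not_le.1 hj')
            omega
          have hmem : (⟨(j : ℕ) + 1, hlt⟩ : Fin k) ∈ Finset.Icc i' j' := by
            rw [Finset.mem_Icc, Fin.le_def, Fin.le_def]
            have := Fin.le_def.1 hle
            have := Fin.lt_def.1 (not_le.1 hj')
            exact ⟨by simp only; omega, by simp only; omega⟩
          exact hj _ (hT hmem) rfl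
        have hB : Finset.Icc i' j' ⊆ T.filter fun l => j < l := fun l hl =>
          Finset.mem_filter.2 ⟨hT hl, hji'.trans_le (Finset.mem_Icc.1 hl).1⟩
        have hA : ¬ (i' ≤ j' ∧ Finset.Icc i' j' ⊆ T.filter fun l => l ≤ j) := fun h =>
          hj' (Finset.mem_filter.1 (h.2 (Finset.right_mem_Icc.2 hij))).2
        rw [if_neg hA, if_pos ⟨hij, hB⟩, zero_add]
    · have hA : ¬ (i' ≤ j' ∧ Finset.Icc i' j' ⊆ T.filter fun l => l ≤ j) := fun h =>
        hT (h.2.trans (Finset.filter_subset _ _))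
      have hB : ¬ (i' ≤ j' ∧ Finset.Icc i' j' ⊆ T.filter fun l => j < l) := fun h =>
        hT (h.2.trans (Finset.filter_subset _ _))
      rw [if_neg (fun h => hT h.2), if_neg hA, if_neg hB, add_zero]
  · rw [if_neg (fun h => hij h.1), if_neg (fun h => hij h.1), if_neg (fun h => hij h.1), add_zero]

/-- The interval sum of the empty set vanishes. -/
theorem isum_empty (e : Fin k → Fin k → ℤ) : ISUM⟪k, e, (∅ : Finset (Fin k))⟫ = 0 := by
  refine Finset.sum_eq_zero fun i' _ => Finset.sum_eq_zero fun j' _ => ?_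
  rw [if_neg]
  rintro ⟨hij, hsub⟩
  exact Finset.notMem_empty _ (hsub (Finset.left_mem_Icc.2 hij))

/-- **Run decomposition.** If `|J| + ∑ {e_I | I ⊆ J} ≥ 1` for every interval `J`, then
`|T| + ∑ {e_I | I ⊆ T} ≥ 1` for every non-empty set `T` of coordinates: `T` is the disjoint union
of its maximal runs, and an interval inside `T` lies inside exactly one run. -/
theorem isum_runs (e : Fin k → Fin k → ℤ)
    (h : ∀ i j : Fin k, i ≤ j → 1 ≤ ((Finset.Icc i j).card : ℤ) + ISUM⟪k, e, Finset.Icc i j⟫) :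
    ∀ T : Finset (Fin k), T.Nonempty → 1 ≤ (T.card : ℤ) + ISUM⟪k, e, T⟫ := by
  intro T
  induction T using Finset.strongInduction with
  | H T ih => ?_
  intro hT
  -- the first run `[m₀, j]` of `T`
  set m₀ := T.min' hT with hm₀
  have hm₀T : m₀ ∈ T := Finset.min'_mem T hT
  have hm₀le : ∀ l ∈ T, m₀ ≤ l := fun l hl => Finset.min'_le T l hl
  set A := Finset.univ.filter (fun j : Fin k => Finset.Icc m₀ j ⊆ T) with hA
  have hAm : m₀ ∈ A := by
    rw [hA, Finset.mem_filter, Finset.Icc_self]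
    exact ⟨Finset.mem_univ _, Finset.singleton_subset_iff.2 hm₀T⟩
  set j := A.max' ⟨m₀, hAm⟩ with hj
  have hjA : Finset.Icc m₀ j ⊆ T := (Finset.mem_filter.1 (Finset.max'_mem A ⟨m₀, hAm⟩)).2
  have hm₀j : m₀ ≤ j := Finset.le_max' A m₀ hAm
  -- `j + 1 ∉ T`
  have hsucc : ∀ l ∈ T, (l : ℕ) ≠ (j : ℕ) + 1 := by
    intro l hl hlj
    have hlA : l ∈ A := by
      rw [hA, Finset.mem_filter]
      refine ⟨Finset.mem_univ _, fun x hx => ?_⟩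
      rw [Finset.mem_Icc] at hx
      by_cases hxj : x ≤ j
      · exact hjA (Finset.mem_Icc.2 ⟨hx.1, hxj⟩)
      · have : x = l := by
          apply Fin.ext
          have := Fin.lt_def.1 (not_le.1 hxj)
          have := Fin.le_def.1 hx.2
          omega
        rw [this]
        exact hl
    have := Fin.le_def.1 (Finset.le_max' A l hlA)
    rw [← hj] at this
    omega
  -- the run and the rest
  have hrun : (T.filter fun l => l ≤ j) = Finset.Icc m₀ j := by
    ext l
    rw [Finset.mem_filter, Finset.mem_Icc]
    exact ⟨fun h => ⟨hm₀le l h.1, h.2⟩, fun h => ⟨hjA (Finset.mem_Icc.2 h), h.2⟩⟩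
  have hsplit := isum_split e T j hsucc
  have hcard := Finset.card_filter_add_card_filter_not (s := T) (fun l => l ≤ j)
  have hneg : (T.filter fun l => ¬ l ≤ j) = T.filter fun l => j < l :=
    Finset.filter_congr fun l _ => not_le
  rw [hneg, hrun] at hcard
  rw [hrun] at hsplit
  have hcardZ : (T.card : ℤ) = ((Finset.Icc m₀ j).card : ℤ) +
      ((T.filter fun l => j < l).card : ℤ) := by
    rw [← hcard]
    push_cast
    ring
  rw [hcardZ, hsplit]
  have h1 := h m₀ j hm₀j
  by_cases hB : (T.filter fun l => j < l).Nonempty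
  · have hBlt : (T.filter fun l => j < l) ⊂ T := by
      refine Finset.filter_ssubset.2 ⟨m₀, hm₀T, ?_⟩
      exact not_lt.2 hm₀j
    have h2 := ih _ hBlt hB
    linarith
  · rw [Finset.not_nonempty_iff_eq_empty] at hB
    rw [hB, isum_empty, Finset.card_empty, Nat.cast_zero]
    linarith

/-- The interval sum of an interval `[i, j]`, in the registered shape. -/
theorem isum_Icc (e : Fin k → Fin k → ℤ) (i j : Fin k) :
    ISUM⟪k, e, Finset.Icc i j⟫ =
      ∑ i' : Fin k, ∑ j' : Fin k, if i ≤ i' ∧ i' ≤ j' ∧ j' ≤ j then e i' j' else 0 := by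
  refine Finset.sum_congr rfl fun i' _ => Finset.sum_congr rfl fun j' _ => ?_
  refine if_congr ⟨?_, ?_⟩ rfl rfl
  · rintro ⟨hij, hsub⟩
    have := (Finset.Icc_subset_Icc_iff hij).1 hsub
    exact ⟨this.1, hij, this.2⟩
  · rintro ⟨h1, h2, h3⟩
    exact ⟨h2, (Finset.Icc_subset_Icc_iff h2).2 ⟨h1, h3⟩⟩

/-- The sector sum `∑ {γₐ | Iₐ ⊆ π {i, …}}` of the interval family of `e` is the interval sum of
the set `π {i, …}`. -/
theorem sum_filter_eq_isum (e : Fin k → Fin k → ℤ) (π : Equiv.Perm (Fin k)) (i : Fin k) :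
    ∑ p ∈ Finset.univ.filter (fun p : Fin k × Fin k => ∀ l ∈ ISET⟪k, p⟫, i ≤ π.symm l),
        IEXP⟪e, p⟫ = ISUM⟪k, e, ((Finset.Ici i).map π.toEmbedding)⟫ := by
  rw [Finset.sum_filter, Fintype.sum_prod_type]
  refine Finset.sum_congr rfl fun i' _ => Finset.sum_congr rfl fun j' _ => ?_
  by_cases hij : i' ≤ j'
  · simp only [hij, if_true, true_and]
    refine if_congr ⟨fun h l hl => ?_, fun h l hl => ?_⟩ rfl rfl
    · exact Finset.mem_map_equiv.2 (Finset.mem_Ici.2 (h l hl))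
    · exact Finset.mem_Ici.1 (Finset.mem_map_equiv.1 (h hl))
  · simp [hij]

/-- Every interval `[i, j]` is the image `π {i₀, …, n}` of a final segment under a permutation
(a rotation), with `n - i₀ = j - i`. -/
theorem exists_perm_map_Ici_eq_Icc {n : ℕ} {i j : Fin (n + 1)} (hij : i ≤ j) :
    ∃ (π : Equiv.Perm (Fin (n + 1))) (i₀ : Fin (n + 1)),
      (n + 1 - 1 - (i₀ : ℕ) : ℕ) = (j : ℕ) - (i : ℕ) ∧
      (Finset.Ici i₀).map π.toEmbedding = Finset.Icc i j := by
  have hi := i.isLt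
  have hj := j.isLt
  have hij' := Fin.le_def.1 hij
  refine ⟨(Equiv.addRight (⟨n - j, by omega⟩ : Fin (n + 1))).symm, ⟨n - j + i, by omega⟩,
    by simp only; omega, ?_⟩
  ext l
  simp only [Finset.mem_map_equiv, Equiv.symm_symm, Equiv.coe_addRight, Finset.mem_Ici,
    Finset.mem_Icc, Fin.le_def, Fin.val_add]
  have hl := l.isLt
  by_cases hlj : (l : ℕ) ≤ j
  · rw [Nat.mod_eq_of_lt (by omega)]
    omega
  · rw [Nat.mod_eq_sub_mod (by omega), Nat.mod_eq_of_lt (by omega)]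
    omega

/-- The image of a final segment under a permutation is non-empty and has `n + 1 - i₀`
elements. -/
theorem card_map_Ici {n : ℕ} (π : Equiv.Perm (Fin (n + 1))) (i₀ : Fin (n + 1)) :
    ((Finset.Ici i₀).map π.toEmbedding).Nonempty ∧
      ((Finset.Ici i₀).map π.toEmbedding).card = n + 1 - (i₀ : ℕ) := by
  refine ⟨⟨π i₀, ?_⟩, by rw [Finset.card_map, Fin.card_Ici]⟩
  rw [Finset.mem_map_equiv, Equiv.symm_apply_apply]
  exact Finset.mem_Ici.2 le_rfl

/-- **The sector condition is the interval condition.** For the interval family of `e`, the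
exponent condition of every sector and every coordinate is equivalent to the registered
interval condition `0 ≤ (j - i) + ∑ {e_I | I ⊆ [i, j]}`. -/
theorem sector_condition_iff {n : ℕ} (e : Fin (n + 1) → Fin (n + 1) → ℤ) :
    (∀ (π : Equiv.Perm (Fin (n + 1))) (i : Fin (n + 1)), 0 ≤ ((n + 1 - 1 - (i : ℕ) : ℕ) : ℤ) +
      ∑ p ∈ Finset.univ.filter (fun p : Fin (n + 1) × Fin (n + 1) =>
        ∀ l ∈ ISET⟪(n + 1), p⟫, i ≤ π.symm l), IEXP⟪e, p⟫) ↔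
    ∀ i j : Fin (n + 1), i ≤ j → 0 ≤ ((j : ℤ) - (i : ℤ)) +
      ∑ i' : Fin (n + 1), ∑ j' : Fin (n + 1),
        if i ≤ i' ∧ i' ≤ j' ∧ j' ≤ j then e i' j' else 0 := by
  constructor
  · intro h i j hij
    obtain ⟨π, i₀, hi₀, hT⟩ := exists_perm_map_Ici_eq_Icc hij
    have := h π i₀
    rw [sum_filter_eq_isum, hT, isum_Icc, hi₀] at this
    have hij' := Fin.le_def.1 hij
    have hcast : (((j : ℕ) - (i : ℕ) : ℕ) : ℤ) = (j : ℤ) - (i : ℤ) := by omega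
    rwa [hcast] at this
  · intro h π i₀
    rw [sum_filter_eq_isum]
    obtain ⟨hne, hcard⟩ := card_map_Ici π i₀
    have h1 := isum_runs e (fun i j hij => ?_) _ hne
    · rw [hcard] at h1
      have := i₀.isLt
      omega
    · rw [isum_Icc, Fin.card_Icc]
      have := h i j hij
      have hij' := Fin.le_def.1 hij
      omega

/-! ### From atoms to weights -/

/-- In the picture `v = 1 - x` the atom kernel is the weight of the interval family of `e`. -/
theorem atomFun_one_sub (a : Fin k → ℕ) (e : Fin k → Fin k → ℤ) (v : Fin k → ℝ) :
    ATOM⟪k, a, e, (fun i => 1 - v i)⟫ =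
      WEIGHT⟪(fun p : Fin k × Fin k => ISET⟪k, p⟫), (fun p : Fin k × Fin k => IEXP⟪e, p⟫),
        a, v⟫ := by
  -- adapted from `integrableOn_atomFun_add_diag` (stub `stub_atomReduction`)
  congr 1
  rw [Fintype.prod_prod_type]
  refine Finset.prod_congr rfl fun i _ => Finset.prod_congr rfl fun j _ => ?_
  simp only
  split_ifs with hij
  · have hset : Finset.univ.filter (fun l : Fin k => i ≤ l ∧ l ≤ j) = Finset.Icc i j := by
      ext l; simp
    rw [← hset, Finset.prod_filter]
  · simp

/-- The interval sets are non-empty. -/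
theorem iset_nonempty (p : Fin k × Fin k) : (ISET⟪k, p⟫).Nonempty := by
  split_ifs with h
  · exact Finset.nonempty_Icc.2 h
  · exact Finset.singleton_nonempty _

/-- **The convergence criterion in positive dimension.** -/
theorem atomConvergence_succ {n : ℕ} (q : ℚ) (a : Fin (n + 1) → ℕ)
    (e : Fin (n + 1) → Fin (n + 1) → ℤ) (hq : q ≠ 0) :
    IntegrableOn (fun x => (q : ℝ) * ATOM⟪(n + 1), a, e, x⟫)
        {x : Fin (n + 1) → ℝ | ∀ i, x i ∈ Ioo (0:ℝ) 1} ↔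
      ∀ i j : Fin (n + 1), i ≤ j → 0 ≤ ((j : ℤ) - (i : ℤ)) +
        ∑ i' : Fin (n + 1), ∑ j' : Fin (n + 1),
          if i ≤ i' ∧ i' ≤ j' ∧ j' ≤ j then e i' j' else 0 := by
  have hq' : IsUnit (q : ℝ) := isUnit_iff_ne_zero.2 (by exact_mod_cast hq)
  rw [IntegrableOn, integrable_const_mul_iff hq', ← IntegrableOn,
    ← integrableOn_cube_comp_one_sub_iff,
    integrableOn_congr_fun (fun v _ => atomFun_one_sub a e v) (measurableSet_cube (n + 1)),
    integrableOn_weightV_iff _ iset_nonempty, ← sector_condition_iff e]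

end AtomConvergence

/-! ### Dimension zero and the stub -/

open AtomConvergence in
/-- **Tool stub `atomConvergence`** (convergence criterion of cubical atoms). The atom
`q · xᵃ · ∏_{i ≤ j} (1 - xᵢ ⋯ xⱼ)^{e i j}` (`q ≠ 0`) is absolutely integrable on the open cube iff
for every interval `J = [i, j]` one has `(j - i) + ∑_{I ⊆ J} e_I ≥ 0` (Brown's criterion in cubical
coordinates). Sectors and nested monomial charts reduce it to monomial integrability; the
exponent conditions of the sectors are the interval conditions by the run decomposition of a set
of coordinates. -/
theorem atomConvergence : ∀ (k : ℕ) (q : ℚ) (a : Fin k → ℕ) (e : Fin k → Fin k → ℤ), q ≠ 0 → (MeasureTheory.IntegrableOn (fun x : Fin k → ℝ => (q : ℝ) * ((∏ i : Fin k, x i ^ a i) * ∏ i : Fin k, ∏ j : Fin k, if i ≤ j then (1 - (∏ l : Fin k, if i ≤ l ∧ l ≤ j then x l else 1)) ^ e i j else 1)) {x : Fin k → ℝ | ∀ i, x i ∈ Set.Ioo (0:ℝ) 1} MeasureTheory.volume ↔ ∀ i j : Fin k, i ≤ j → 0 ≤ ((j : ℤ) - (i : ℤ)) + ∑ i' : Fin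 k, ∑ j' : Fin k, if i ≤ i' ∧ i' ≤ j' ∧ j' ≤ j then e i' j' else 0) := by
  intro k q a e hq
  cases k with
  | zero =>
    refine ⟨fun _ i => i.elim0, fun _ => ?_⟩
    have : IsFiniteMeasure (volume : Measure (Fin 0 → ℝ)) := by
      rw [volume_pi, Measure.pi_of_empty]; infer_instance
    simp only [Finset.univ_eq_empty, Finset.prod_empty, mul_one]
    exact integrableOn_const
  | succ n => exact atomConvergence_succ q a e hq

end Summit.KontsevichZagierPeriods.DihedralNormalForm.TorusDescent
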